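import Summits.Langlands.Langlands.Theorems.SqrtFiveQuarticCoversE7DescentAlgebra

/-!
# Route `Langlands/SqrtFiveQuarticCovers`, sheet 4.5 row 8 — 2-descent for `W = 49a4`: LOCAL part

`W : y² = x(x² + 294x − 343)` (`≅` Cremona `49a4` = LMFDB `49.a1`, minimal model
`[1,−1,0,−1822,30393]`) and its 2-isogenous curve `W' : Y² = X(X² − 588X + 87808)` (`≅ 49a3 =
49.a2`, minimal model `[1,−1,0,−107,552]`).  This file proves the LOCAL half of the complete
2-isogeny descent (eng-8 g3, E7-MW-FERMAT, lead GO 23:34:25Z):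

* §1 the images of the connecting maps are the torsion images — every other class is EMPTY by a
  congruence certificate: on `W` the classes `d ∈ {−1, 7, −49, 343}` of `x = d·s²/e²` die mod `16`
  (`decide` over `ZMod 16`); on `W'` the classes `2` and `14` die 2-adically at depth `2⁸` through
  the parity chain `M = 2M₁ ⇒ N = 4N₁ ⇒ M₁ = 2M₂ ⇒ (M₂ odd: ≡ 12 resp. 28 mod 32) ⇒ M₂ = 2M₃ ⇒
  ≡ 8 mod 16`; negative classes on `W'` die at `ℝ`.
* §2 NORMALISATION: hence every affine point of `W` with `x ≠ 0` has `x = r²` or `−343/x = r²`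
  (`W_sq_or_transl_sq`), and every affine point of `W'` with `X ≠ 0` has `X = R²` or `87808/X = R²`
  (`Wp_sq_or_transl_sq`) — «class ∈ {1, class of T}», the class of `T` being moved to class `1`
  by the translation `x ↦ b/x`.

HONEST STATUS: kernel arithmetic about two explicit curves over `ℚ`; no named input; not a modularity
statement.  References: Silverman–Tate III.4–5; Cremona 1997 Table 1 (49a3, 49a4); kit j319940,
j320107, j320342 (PARI cross-checks: `ellrank` = `[0,0,0,[]]`, `#Ш_an = 1` for all four curves).
-/

set_option linter.dupNamespace false -- project-wide option; `Summit.Langlands.Langlands` is the mandated namespace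

namespace Summit.Langlands.Langlands.Theorems.SqrtFiveQuarticCovers

/-! ### §1 Local certificates -/

section Kills

/-- Transport of an integer identity `N² = F(M, e)` to `ZMod m`. [folklore] -/
theorem intCast_sq_eq {m : ℕ} {N F : ℤ} (h : N ^ 2 = F) : ((N : ZMod m)) ^ 2 = (F : ZMod m) := by
  rw [← Int.cast_pow, h]

/-- `W`, class `d = −1`: `N² = −M⁴ + 294M²e² + 343e⁴` has no solution with `gcd(M, e) = 1`
(mod `16`: both `M`, `e` would be even). [folklore] -/
theorem W_kill_neg1 {M e N : ℤ} (hcop : Int.gcd M e = 1)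
    (h : N ^ 2 = -M ^ 4 + 294 * M ^ 2 * e ^ 2 + 343 * e ^ 4) : False := by
  have key : ∀ m f n : ZMod 16, n ^ 2 = -m ^ 4 + 294 * m ^ 2 * f ^ 2 + 343 * f ^ 4 →
      (8 : ZMod 16) * m = 0 ∧ (8 : ZMod 16) * f = 0 := by decide
  have hc := intCast_sq_eq (m := 16) h
  push_cast at hc
  obtain ⟨hM, hE⟩ := key _ _ _ hc
  exact false_of_dvd_of_dvd_of_gcd_eq_one (d := 2) (by norm_num)
    ((zmod_mul_intCast_eq_zero_iff (m := 16) (k := 8) (d := 2) rfl (by norm_num) M).mp (by exact_mod_cast hM))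
    ((zmod_mul_intCast_eq_zero_iff (m := 16) (k := 8) (d := 2) rfl (by norm_num) e).mp (by exact_mod_cast hE))
    hcop

/-- `W`, class `d = 7`: `N² = 7M⁴ + 294M²e² − 49e⁴` has no solution with `gcd(M, e) = 1`
(mod `16`). [folklore] -/
theorem W_kill_7 {M e N : ℤ} (hcop : Int.gcd M e = 1)
    (h : N ^ 2 = 7 * M ^ 4 + 294 * M ^ 2 * e ^ 2 - 49 * e ^ 4) : False := by
  have key : ∀ m f n : ZMod 16, n ^ 2 = 7 * m ^ 4 + 294 * m ^ 2 * f ^ 2 - 49 * f ^ 4 →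
      (8 : ZMod 16) * m = 0 ∧ (8 : ZMod 16) * f = 0 := by decide
  have hc := intCast_sq_eq (m := 16) h
  push_cast at hc
  obtain ⟨hM, hE⟩ := key _ _ _ hc
  exact false_of_dvd_of_dvd_of_gcd_eq_one (d := 2) (by norm_num)
    ((zmod_mul_intCast_eq_zero_iff (m := 16) (k := 8) (d := 2) rfl (by norm_num) M).mp (by exact_mod_cast hM))
    ((zmod_mul_intCast_eq_zero_iff (m := 16) (k := 8) (d := 2) rfl (by norm_num) e).mp (by exact_mod_cast hE))
    hcop

/-- `W`, class `d = −49` (`≡` class `−1`): `N² = −49M⁴ + 294M²e² + 7e⁴` has no solution with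
`gcd(M, e) = 1` (mod `16`). [folklore] -/
theorem W_kill_neg49 {M e N : ℤ} (hcop : Int.gcd M e = 1)
    (h : N ^ 2 = -49 * M ^ 4 + 294 * M ^ 2 * e ^ 2 + 7 * e ^ 4) : False := by
  have key : ∀ m f n : ZMod 16, n ^ 2 = -49 * m ^ 4 + 294 * m ^ 2 * f ^ 2 + 7 * f ^ 4 →
      (8 : ZMod 16) * m = 0 ∧ (8 : ZMod 16) * f = 0 := by decide
  have hc := intCast_sq_eq (m := 16) h
  push_cast at hc
  obtain ⟨hM, hE⟩ := key _ _ _ hc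
  exact false_of_dvd_of_dvd_of_gcd_eq_one (d := 2) (by norm_num)
    ((zmod_mul_intCast_eq_zero_iff (m := 16) (k := 8) (d := 2) rfl (by norm_num) M).mp (by exact_mod_cast hM))
    ((zmod_mul_intCast_eq_zero_iff (m := 16) (k := 8) (d := 2) rfl (by norm_num) e).mp (by exact_mod_cast hE))
    hcop

/-- `W`, class `d = 343` (`≡` class `7`): `N² = 343M⁴ + 294M²e² − e⁴` has no solution with
`gcd(M, e) = 1` (mod `16`). [folklore] -/
theorem W_kill_343 {M e N : ℤ} (hcop : Int.gcd M e = 1)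
    (h : N ^ 2 = 343 * M ^ 4 + 294 * M ^ 2 * e ^ 2 - e ^ 4) : False := by
  have key : ∀ m f n : ZMod 16, n ^ 2 = 343 * m ^ 4 + 294 * m ^ 2 * f ^ 2 - f ^ 4 →
      (8 : ZMod 16) * m = 0 ∧ (8 : ZMod 16) * f = 0 := by decide
  have hc := intCast_sq_eq (m := 16) h
  push_cast at hc
  obtain ⟨hM, hE⟩ := key _ _ _ hc
  exact false_of_dvd_of_dvd_of_gcd_eq_one (d := 2) (by norm_num)
    ((zmod_mul_intCast_eq_zero_iff (m := 16) (k := 8) (d := 2) rfl (by norm_num) M).mp (by exact_mod_cast hM))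
    ((zmod_mul_intCast_eq_zero_iff (m := 16) (k := 8) (d := 2) rfl (by norm_num) e).mp (by exact_mod_cast hE))
    hcop

/-- `2 ∣ M` read off `ZMod 8` / `ZMod 16` / `ZMod 32`. [folklore] -/
theorem two_dvd_of_zmod8 {M : ℤ} (h : (4 : ZMod 8) * (M : ZMod 8) = 0) : (2 : ℤ) ∣ M :=
  (zmod_mul_intCast_eq_zero_iff (m := 8) (k := 4) (d := 2) rfl (by norm_num) M).mp (by exact_mod_cast h)

/-- `2 ∣ M` read off `ZMod 16`. [folklore] -/
theorem two_dvd_of_zmod16 {M : ℤ} (h : (8 : ZMod 16) * (M : ZMod 16) = 0) : (2 : ℤ) ∣ M :=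
  (zmod_mul_intCast_eq_zero_iff (m := 16) (k := 8) (d := 2) rfl (by norm_num) M).mp (by exact_mod_cast h)

/-- `16·M = 0` in `ZMod 32` for even `M`. [folklore] -/
theorem zmod32_of_two_dvd {M : ℤ} (h : (2 : ℤ) ∣ M) : (16 : ZMod 32) * (M : ZMod 32) = 0 := by
  have := (zmod_mul_intCast_eq_zero_iff (m := 32) (k := 16) (d := 2) rfl (by norm_num) M).mpr h
  exact_mod_cast this

/-- `4·e ≠ 0` in `ZMod 8` for odd `e`. [folklore] -/
theorem zmod8_ne_of_not_two_dvd {e : ℤ} (h : ¬ (2 : ℤ) ∣ e) : (4 : ZMod 8) * (e : ZMod 8) ≠ 0 :=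
  fun h0 => h (two_dvd_of_zmod8 h0)

/-- `16 ∣ N²` ⇒ `4 ∣ N`. [folklore] -/
theorem four_dvd_of_sixteen_dvd_sq {N : ℤ} (h : (16 : ℤ) ∣ N ^ 2) : (4 : ℤ) ∣ N := by
  have : (4 : ℤ) ^ 2 ∣ N ^ 2 := by norm_num; exact h
  exact (Int.pow_dvd_pow_iff two_ne_zero).mp this

/-- **`W'`, class `2` is empty:** `N² = 2M⁴ − 588M²e² + 43904e⁴` has no solution with
`gcd(M, e) = 1` — 2-adic parity chain of depth `2⁸` (see module docstring). [folklore] -/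
theorem Wp_kill_2 {M e N : ℤ} (hcop : Int.gcd M e = 1)
    (h : N ^ 2 = 2 * M ^ 4 - 588 * M ^ 2 * e ^ 2 + 43904 * e ^ 4) : False := by
  -- step 1: `M` is even (mod 8), hence `e` is odd
  have k1 : ∀ m f n : ZMod 8, n ^ 2 = 2 * m ^ 4 - 588 * m ^ 2 * f ^ 2 + 43904 * f ^ 4 →
      (4 : ZMod 8) * m = 0 := by decide
  have h1 := intCast_sq_eq (m := 8) h
  push_cast at h1
  obtain ⟨M₁, rfl⟩ := two_dvd_of_zmod8 (k1 _ _ _ h1)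
  have he : ¬ (2 : ℤ) ∣ e := fun he =>
    false_of_dvd_of_dvd_of_gcd_eq_one (d := 2) (by norm_num) (dvd_mul_right 2 M₁) he hcop
  -- step 2: `N = 4N₁`, `N₁² = 2M₁⁴ − 147M₁²e² + 2744e⁴`
  obtain ⟨N₁, rfl⟩ := four_dvd_of_sixteen_dvd_sq (N := N)
    ⟨2 * M₁ ^ 4 - 147 * M₁ ^ 2 * e ^ 2 + 2744 * e ^ 4, by linear_combination h⟩
  have h2 : N₁ ^ 2 = 2 * M₁ ^ 4 - 147 * M₁ ^ 2 * e ^ 2 + 2744 * e ^ 4 := by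
    have h16 : (16 : ℤ) * N₁ ^ 2 = 16 * (2 * M₁ ^ 4 - 147 * M₁ ^ 2 * e ^ 2 + 2744 * e ^ 4) := by
      linear_combination h
    exact mul_left_cancel₀ (by norm_num : (16 : ℤ) ≠ 0) h16
  -- step 3: `M₁` is even (mod 8, `e` odd)
  have k3 : ∀ m f n : ZMod 8, n ^ 2 = 2 * m ^ 4 - 147 * m ^ 2 * f ^ 2 + 2744 * f ^ 4 →
      (4 : ZMod 8) * m = 0 ∨ (4 : ZMod 8) * f = 0 := by decide
  have h3 := intCast_sq_eq (m := 8) h2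
  push_cast at h3
  obtain ⟨M₂, rfl⟩ := two_dvd_of_zmod8 ((k3 _ _ _ h3).resolve_right (zmod8_ne_of_not_two_dvd he))
  have h4 : N₁ ^ 2 = 32 * M₂ ^ 4 - 588 * M₂ ^ 2 * e ^ 2 + 2744 * e ^ 4 := by linear_combination h2
  -- step 4: `M₂` is even (else `N₁² ≡ 12 mod 32`)
  have k4 : ∀ m f : ZMod 32, (16 : ZMod 32) * m ≠ 0 → (16 : ZMod 32) * f ≠ 0 →
      32 * m ^ 4 - 588 * m ^ 2 * f ^ 2 + 2744 * f ^ 4 = 12 := by decide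
  have k4' : ∀ n : ZMod 32, n ^ 2 ≠ 12 := by decide
  have hM₂ : (2 : ℤ) ∣ M₂ := by
    by_contra hM₂
    have h5 := intCast_sq_eq (m := 32) h4
    push_cast at h5
    have hm : (16 : ZMod 32) * (M₂ : ZMod 32) ≠ 0 := fun h0 =>
      hM₂ ((zmod_mul_intCast_eq_zero_iff (m := 32) (k := 16) (d := 2) rfl (by norm_num) M₂).mp
        (by exact_mod_cast h0))
    have hf : (16 : ZMod 32) * (e : ZMod 32) ≠ 0 := fun h0 =>
      he ((zmod_mul_intCast_eq_zero_iff (m := 32) (k := 16) (d := 2) rfl (by norm_num) e).mp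
        (by exact_mod_cast h0))
    rw [k4 _ _ hm hf] at h5
    exact k4' _ h5
  obtain ⟨M₃, rfl⟩ := hM₂
  have h6 : N₁ ^ 2 = 512 * M₃ ^ 4 - 2352 * M₃ ^ 2 * e ^ 2 + 2744 * e ^ 4 := by linear_combination h4
  -- step 5: contradiction mod 16 (`e` odd)
  have k6 : ∀ m f n : ZMod 16, n ^ 2 = 512 * m ^ 4 - 2352 * m ^ 2 * f ^ 2 + 2744 * f ^ 4 →
      (8 : ZMod 16) * f = 0 := by decide
  have h7 := intCast_sq_eq (m := 16) h6
  push_cast at h7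
  exact he (two_dvd_of_zmod16 (k6 _ _ _ h7))

/-- **`W'`, class `14` is empty:** `N² = 14M⁴ − 588M²e² + 6272e⁴` has no solution with
`gcd(M, e) = 1` — the same 2-adic chain (`≡ 28 mod 32` at step 4). [folklore] -/
theorem Wp_kill_14 {M e N : ℤ} (hcop : Int.gcd M e = 1)
    (h : N ^ 2 = 14 * M ^ 4 - 588 * M ^ 2 * e ^ 2 + 6272 * e ^ 4) : False := by
  have k1 : ∀ m f n : ZMod 8, n ^ 2 = 14 * m ^ 4 - 588 * m ^ 2 * f ^ 2 + 6272 * f ^ 4 →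
      (4 : ZMod 8) * m = 0 := by decide
  have h1 := intCast_sq_eq (m := 8) h
  push_cast at h1
  obtain ⟨M₁, rfl⟩ := two_dvd_of_zmod8 (k1 _ _ _ h1)
  have he : ¬ (2 : ℤ) ∣ e := fun he =>
    false_of_dvd_of_dvd_of_gcd_eq_one (d := 2) (by norm_num) (dvd_mul_right 2 M₁) he hcop
  obtain ⟨N₁, rfl⟩ := four_dvd_of_sixteen_dvd_sq (N := N)
    ⟨14 * M₁ ^ 4 - 147 * M₁ ^ 2 * e ^ 2 + 392 * e ^ 4, by linear_combination h⟩
  have h2 : N₁ ^ 2 = 14 * M₁ ^ 4 - 147 * M₁ ^ 2 * e ^ 2 + 392 * e ^ 4 := by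
    have h16 : (16 : ℤ) * N₁ ^ 2 = 16 * (14 * M₁ ^ 4 - 147 * M₁ ^ 2 * e ^ 2 + 392 * e ^ 4) := by
      linear_combination h
    exact mul_left_cancel₀ (by norm_num : (16 : ℤ) ≠ 0) h16
  have k3 : ∀ m f n : ZMod 8, n ^ 2 = 14 * m ^ 4 - 147 * m ^ 2 * f ^ 2 + 392 * f ^ 4 →
      (4 : ZMod 8) * m = 0 ∨ (4 : ZMod 8) * f = 0 := by decide
  have h3 := intCast_sq_eq (m := 8) h2
  push_cast at h3
  obtain ⟨M₂, rfl⟩ := two_dvd_of_zmod8 ((k3 _ _ _ h3).resolve_right (zmod8_ne_of_not_two_dvd he))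
  have h4 : N₁ ^ 2 = 224 * M₂ ^ 4 - 588 * M₂ ^ 2 * e ^ 2 + 392 * e ^ 4 := by linear_combination h2
  have k4 : ∀ m f : ZMod 32, (16 : ZMod 32) * m ≠ 0 → (16 : ZMod 32) * f ≠ 0 →
      224 * m ^ 4 - 588 * m ^ 2 * f ^ 2 + 392 * f ^ 4 = 28 := by decide
  have k4' : ∀ n : ZMod 32, n ^ 2 ≠ 28 := by decide
  have hM₂ : (2 : ℤ) ∣ M₂ := by
    by_contra hM₂
    have h5 := intCast_sq_eq (m := 32) h4
    push_cast at h5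
    have hm : (16 : ZMod 32) * (M₂ : ZMod 32) ≠ 0 := fun h0 =>
      hM₂ ((zmod_mul_intCast_eq_zero_iff (m := 32) (k := 16) (d := 2) rfl (by norm_num) M₂).mp
        (by exact_mod_cast h0))
    have hf : (16 : ZMod 32) * (e : ZMod 32) ≠ 0 := fun h0 =>
      he ((zmod_mul_intCast_eq_zero_iff (m := 32) (k := 16) (d := 2) rfl (by norm_num) e).mp
        (by exact_mod_cast h0))
    rw [k4 _ _ hm hf] at h5
    exact k4' _ h5
  obtain ⟨M₃, rfl⟩ := hM₂
  have h6 : N₁ ^ 2 = 3584 * M₃ ^ 4 - 2352 * M₃ ^ 2 * e ^ 2 + 392 * e ^ 4 := by linear_combination h4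
  have k6 : ∀ m f n : ZMod 16, n ^ 2 = 3584 * m ^ 4 - 2352 * m ^ 2 * f ^ 2 + 392 * f ^ 4 →
      (8 : ZMod 16) * f = 0 := by decide
  have h7 := intCast_sq_eq (m := 16) h6
  push_cast at h7
  exact he (two_dvd_of_zmod16 (k6 _ _ _ h7))

end Kills

/-! ### §2 Normalisation: square or translated square -/

/-- **`W`: every affine point with `x ≠ 0` has `x = r²` or `−343/x = r²` (`r ≠ 0`).**  By the class
lemma `x = d·s²/e²` with `d ∣ 343` up to sign, i.e. `d = ±7ᵏ`, `k ≤ 3`; the classes `−1, 7, −49, 343`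
are empty (§1); `1, 49` give `x = □`; `−7, −343` give `−343/x = □`. [folklore] -/
theorem W_sq_or_transl_sq {x y : ℚ} (hx : x ≠ 0) (hy : y ^ 2 = x * (x ^ 2 + 294 * x - 343)) :
    (∃ r : ℚ, r ≠ 0 ∧ x = r ^ 2) ∨ (∃ r : ℚ, r ≠ 0 ∧ -343 / x = r ^ 2) := by
  have hy' : y ^ 2 = x * (x ^ 2 + ((294 : ℤ) : ℚ) * x + ((-343 : ℤ) : ℚ)) := by
    push_cast; linear_combination hy
  obtain ⟨d, b', s, N, e, hdb, he, hs, hse, -, hxd, hN⟩ := descent_class hx hy'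
  have hsQ : (s : ℚ) ≠ 0 := by exact_mod_cast hs
  have heQ : (e : ℚ) ≠ 0 := by exact_mod_cast he.ne'
  have hdvd : d.natAbs ∣ 7 ^ 3 := by
    refine ⟨b'.natAbs, ?_⟩
    have := congrArg Int.natAbs hdb
    rw [Int.natAbs_mul] at this
    simpa using this.symm
  obtain ⟨k, hk, hdk⟩ := (Nat.dvd_prime_pow (by norm_num)).mp hdvd
  interval_cases k <;> norm_num at hdk <;> rcases Int.natAbs_eq_iff.mp hdk with rfl | rfl <;>
    push_cast at hxd hdb hN
  · -- `d = 1`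
    left; exact ⟨s / e, div_ne_zero hsQ heQ, by rw [hxd]; ring⟩
  · -- `d = −1`
    have hb : b' = 343 := by omega
    subst hb
    exact (W_kill_neg1 (N := N) hse (by linear_combination hN)).elim
  · -- `d = 7`
    have hb : b' = -49 := by omega
    subst hb
    exact (W_kill_7 (N := N) hse (by linear_combination hN)).elim
  · -- `d = −7`
    right
    refine ⟨7 * e / s, div_ne_zero (mul_ne_zero (by norm_num) heQ) hsQ, ?_⟩
    rw [hxd]; field_simp; ring
  · -- `d = 49`
    left; exact ⟨7 * s / e, div_ne_zero (mul_ne_zero (by norm_num) hsQ) heQ, by rw [hxd]; ring⟩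
  · -- `d = −49`
    have hb : b' = 7 := by omega
    subst hb
    exact (W_kill_neg49 (N := N) hse (by linear_combination hN)).elim
  · -- `d = 343`
    have hb : b' = -1 := by omega
    subst hb
    exact (W_kill_343 (N := N) hse (by linear_combination hN)).elim
  · -- `d = −343`
    right
    refine ⟨e / s, div_ne_zero heQ hsQ, ?_⟩
    rw [hxd]; field_simp

/-- `pᵃ = p^(a mod 2)·(p^(a/2))²` in the form used for absorbing squares into `s`. [folklore] -/
theorem pow_eq_pow_mod_two_mul_sq (p a : ℕ) : p ^ a = p ^ (a % 2) * (p ^ (a / 2)) ^ 2 := by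
  conv_lhs => rw [← Nat.mod_add_div a 2]
  rw [pow_add, pow_mul]
  ring

/-- **`W'`: every affine point with `X ≠ 0` has `X = R²` or `87808/X = R²` (`R ≠ 0`).**  `X > 0`
(`X² − 588X + 87808 = (X − 294)² + 1372 > 0`); by the class lemma `X = d·s²/e²` with
`0 < d ∣ 87808 = 2⁸·7³`, `d = 2ⁱ7ᵏ = d₀·c²`, `d₀ ∈ {1, 2, 7, 14}`; the classes `2, 14` are empty (§1,
applied to the coprime pair `(c·s, e)`), `1` gives `X = □`, `7` gives `87808/X = (112e/(cs))²`.
[folklore] -/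
theorem Wp_sq_or_transl_sq {X Y : ℚ} (hX : X ≠ 0) (hY : Y ^ 2 = X * (X ^ 2 - 588 * X + 87808)) :
    (∃ R : ℚ, R ≠ 0 ∧ X = R ^ 2) ∨ (∃ R : ℚ, R ≠ 0 ∧ 87808 / X = R ^ 2) := by
  have hY' : Y ^ 2 = X * (X ^ 2 + ((-588 : ℤ) : ℚ) * X + ((87808 : ℤ) : ℚ)) := by
    push_cast; linear_combination hY
  have hpos : 0 < X := descent_pos_of_onCurve hX hY' (by push_cast; nlinarith [sq_nonneg (X - 294)])
  obtain ⟨d, b', s, N, e, hdb, he, hs, hse, hde, hxd, hN⟩ := descent_class hX hY'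
  have hsQ : (s : ℚ) ≠ 0 := by exact_mod_cast hs
  have heQ : (e : ℚ) ≠ 0 := by exact_mod_cast he.ne'
  -- `d > 0`
  have hd0 : 0 < d := by
    have h1 : (0 : ℚ) < (d : ℚ) * ((s : ℚ) ^ 2 / (e : ℚ) ^ 2) := by
      rw [← mul_div_assoc, ← hxd]; exact hpos
    have h2 : (0 : ℚ) < (s : ℚ) ^ 2 / (e : ℚ) ^ 2 := by positivity
    have : (0 : ℚ) < d := (pos_iff_pos_of_mul_pos h1).mpr h2
    exact_mod_cast this
  -- `d = 2ⁱ·7ᵏ`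
  set D : ℕ := d.natAbs with hD
  have hDd : (D : ℤ) = d := Int.natAbs_of_nonneg hd0.le
  have hDdvd : D ∣ 2 ^ 8 * 7 ^ 3 := by
    refine ⟨b'.natAbs, ?_⟩
    have := congrArg Int.natAbs hdb
    rw [Int.natAbs_mul] at this
    simpa using this.symm
  have hsplit : D = Nat.gcd D (2 ^ 8) * Nat.gcd D (7 ^ 3) := by
    rw [← Nat.Coprime.gcd_mul D (by norm_num : Nat.Coprime (2 ^ 8) (7 ^ 3)), Nat.gcd_eq_left hDdvd]
  obtain ⟨i, hi, hDi⟩ := (Nat.dvd_prime_pow Nat.prime_two).mp (Nat.gcd_dvd_right D (2 ^ 8))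
  obtain ⟨k, hk, hDk⟩ := (Nat.dvd_prime_pow (by norm_num : Nat.Prime 7)).mp (Nat.gcd_dvd_right D (7 ^ 3))
  rw [hDi, hDk, pow_eq_pow_mod_two_mul_sq 2 i, pow_eq_pow_mod_two_mul_sq 7 k] at hsplit
  -- `D = d₀ · c²`, `c = 2^(i/2) 7^(k/2)`, `d₀ = 2^(i%2) 7^(k%2)`
  set c : ℕ := 2 ^ (i / 2) * 7 ^ (k / 2) with hc
  have hc0 : (c : ℚ) ≠ 0 := by positivity
  have hcZ0 : (c : ℤ) ≠ 0 := by positivity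
  have hDc : D = 2 ^ (i % 2) * 7 ^ (k % 2) * c ^ 2 := by rw [hsplit, hc]; ring
  -- `gcd(c·s, e) = 1`
  have hcse : Int.gcd ((c : ℤ) * s) e = 1 := by
    have hcd : (c : ℤ) ∣ d := ⟨2 ^ (i % 2) * 7 ^ (k % 2) * c, by rw [← hDd, hDc]; push_cast; ring⟩
    have hce : IsCoprime (c : ℤ) (e : ℤ) := by
      have hde' : IsCoprime d (e : ℤ) := Int.isCoprime_iff_gcd_eq_one.mpr hde
      exact hde'.of_isCoprime_of_dvd_left hcd
    exact Int.isCoprime_iff_gcd_eq_one.mp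
      (hce.mul_left (Int.isCoprime_iff_gcd_eq_one.mpr hse))
  have hdQ : (d : ℚ) = (2 : ℚ) ^ (i % 2) * 7 ^ (k % 2) * (c : ℚ) ^ 2 := by
    rw [← hDd, hDc]; push_cast; ring
  -- the value of `c² · b'`
  have hcb : (2 : ℤ) ^ (i % 2) * 7 ^ (k % 2) * ((c : ℤ) ^ 2 * b') = 87808 := by
    rw [← hdb, ← hDd, hDc]; push_cast; ring
  rcases Nat.mod_two_eq_zero_or_one i with hi2 | hi2 <;>
    rcases Nat.mod_two_eq_zero_or_one k with hk2 | hk2 <;>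
    simp only [hi2, hk2, pow_zero, pow_one, one_mul, mul_one] at hdQ hcb
  · -- `d₀ = 1`
    left
    exact ⟨c * s / e, div_ne_zero (mul_ne_zero hc0 hsQ) heQ, by rw [hxd, hdQ]; ring⟩
  · -- `d₀ = 7`
    right
    refine ⟨112 * e / (c * s), div_ne_zero (mul_ne_zero (by norm_num) heQ) (mul_ne_zero hc0 hsQ), ?_⟩
    rw [hxd, hdQ]; field_simp; ring
  · -- `d₀ = 2`: the coprime pair `(c s, e)` solves the class-`2` quartic
    exfalso
    refine Wp_kill_2 (M := c * s) (e := e) (N := c * N) hcse ?_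
    have hd' : d = 2 * (c : ℤ) ^ 2 := by rw [← hDd, hDc, hi2, hk2]; push_cast; ring
    have hcb' : (c : ℤ) ^ 2 * b' = 43904 := by linarith [hcb]
    rw [hd'] at hN
    linear_combination (c : ℤ) ^ 2 * hN + (e : ℤ) ^ 4 * hcb'
  · -- `d₀ = 14`
    exfalso
    refine Wp_kill_14 (M := c * s) (e := e) (N := c * N) hcse ?_
    have hd' : d = 14 * (c : ℤ) ^ 2 := by rw [← hDd, hDc, hi2, hk2]; push_cast; ring
    have hcb' : (c : ℤ) ^ 2 * b' = 6272 := by linarith [hcb]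
    rw [hd'] at hN
    linear_combination (c : ℤ) ^ 2 * hN + (e : ℤ) ^ 4 * hcb'

end Summit.Langlands.Langlands.Theorems.SqrtFiveQuarticCovers
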